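import Summits.BirchSwinnertonDyer.BirchSwinnertonDyer.Theorems.ResidualThetaTransportAtTwoSignedMuSeedAtTwoPlusEvenSymplecticFreeParity
import HarnessLib

/-!
# Seed crux `SignedMuSeedAtTwoPlus` (stmt-BirchSwinnertonDyer-21438), line `ct-involution-parity`:
# the evenness hypothesis of S1 is NECESSARY in grade 1 — the witness `𝔽₂[C₂]` with its hyperbolic form

Cell `bsd-wall`, width seat `bsd-wall-rtt-p4-w2` g9 (sixth file on the line's pure algebra).  Parents: p651662
(stub S1 `EvenSymplecticFreeParity` verbatim), p652274 (grades `k ≥ 2` need no evenness).  HONEST FRAMING: THEOREMS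
ONLY; pure algebra; closes no item; BSD is NOT proved by any of this.

## What is proved (one theorem)

`not_freeParity_without_even` — the statement of stub S1 with the evenness clause `B (g^(2^(n-1)) x) x = 0` DELETED is
FALSE.  Witness (`n = 1`, grade `k = 1`): `A = 𝔽₂ × 𝔽₂` with `g` = the swap (so `A = 𝔽₂[C₂]`), `B` = the hyperbolic form
`B((a,b),(c,d)) = (ad + bc)/2 ∈ ℚ/ℤ` — bi-additive, nondegenerate, alternating, `g`-invariant, NOT even
(`B(g(1,0),(1,0)) = 1/2`) — and `N = 1 + g` has `N(A[2]) = N(A) = {(0,0),(1,1)}` of order `2`, `2A ∩ A[2] = 0`, so the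
grade-1 free multiplicity is `log₂ 2 − log₂ 1 = 1`, odd.  Together with p652274 (`k ≥ 2`: evenness superfluous) this
pins the role of the Cassels–Tate evenness input S2 of the line: it is load-bearing exactly against `μ`-summands `Λ/2`.
[folklore]
-/

noncomputable section

set_option autoImplicit false
set_option linter.dupNamespace false

open Finset
open Literature.GroupTheory.FiniteAbelian

namespace Summit.BirchSwinnertonDyer.BirchSwinnertonDyer.Theorems.SignedMuAtTwo.EvenSymplecticFreeParity

/-- **The evenness clause of S1 cannot be dropped (grade 1).** With `A = 𝔽₂[C₂]` (`𝔽₂ × 𝔽₂`, `g` = swap) and the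
hyperbolic form, all hypotheses of `EvenSymplecticFreeParity` except evenness hold, yet the grade-1 free multiplicity
is `1`.  Formally: the statement of the stub with the clause `∀ x, B (g^(2^(n-1)) x) x = 0` removed is false. [folklore] -/
theorem not_freeParity_without_even :
    ¬ ∀ (n : ℕ), 1 ≤ n → ∀ (A : Type) [AddCommGroup A] [Finite A] (g : AddMonoid.End A)
      (B : A →+ A →+ AddCircle (1 : ℚ)),
      g ^ (2 ^ n) = 1 →
      (∀ x, (∀ y, B x y = 0) → x = 0) →
      (∀ x, B x x = 0) →
      (∀ x y, B (g x) (g y) = B x y) →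
      ∀ k, 1 ≤ k →
        Even (Nat.log 2 (Nat.card ↥((((2 ^ (k - 1)) • AddMonoidHom.id A).range ⊓
              AddSubgroup.torsionBy A 2).map (∑ i ∈ Finset.range (2 ^ n), (g ^ i : AddMonoid.End A)) ⊔
            (((2 ^ (k + 1 - 1)) • AddMonoidHom.id A).range ⊓ AddSubgroup.torsionBy A 2))) -
          Nat.log 2 (Nat.card ↥(((2 ^ (k + 1 - 1)) • AddMonoidHom.id A).range ⊓
            AddSubgroup.torsionBy A 2))) := by
  intro h
  -- `1/2 ≠ 0` in `ℚ/ℤ` (also `Literature.NumberTheory.GaloisRepresentations.addCircle_coe_one_half_ne_zero`)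
  have half_ne : (((1 / 2 : ℚ)) : AddCircle (1 : ℚ)) ≠ 0 := by
    intro h0
    rw [AddCircle.coe_eq_zero_iff] at h0
    obtain ⟨m, hm⟩ := h0
    rw [zsmul_eq_mul, mul_one] at hm
    have h2 : (2 * m : ℤ) = 1 := by exact_mod_cast (by rw [hm]; norm_num : (2 * m : ℚ) = 1)
    omega
  -- the witness: `A = 𝔽₂ × 𝔽₂`, `g` = swap
  let A := ZMod 2 × ZMod 2
  let g : AddMonoid.End A := (AddEquiv.prodComm : ZMod 2 × ZMod 2 ≃+ ZMod 2 × ZMod 2).toAddMonoidHom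
  have hg : ∀ x : A, g x = (x.2, x.1) := fun _ ↦ rfl
  have hg2 : g ^ (2 ^ 1) = 1 := by
    ext x <;> simp only [pow_one, pow_two, AddMonoid.End.coe_mul, Function.comp_apply, hg,
      AddMonoid.End.coe_one, id]
  -- `ψ : 𝔽₂ → ℚ/ℤ`, `1 ↦ 1/2`
  let ψ : ZMod 2 →+ AddCircle (1 : ℚ) := ZMod.lift 2 ⟨zmultiplesHom (AddCircle (1 : ℚ))
    (((1 / 2 : ℚ)) : AddCircle (1 : ℚ)), by
      change (2 : ℤ) • (((1 / 2 : ℚ)) : AddCircle (1 : ℚ)) = 0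
      rw [← AddCircle.coe_zsmul, zsmul_eq_mul]
      norm_num [AddCircle.coe_period]⟩
  have hψ1 : ψ 1 = (((1 / 2 : ℚ)) : AddCircle (1 : ℚ)) := by
    change ZMod.lift 2 _ ((1 : ℤ) : ZMod 2) = _
    rw [ZMod.lift_coe]
    exact one_zsmul _
  have hψinj : ∀ a : ZMod 2, ψ a = 0 → a = 0 := by
    intro a ha
    fin_cases a
    · rfl
    · exact absurd (hψ1.symm.trans ha) half_ne
  -- the hyperbolic form `h((a,b),(c,d)) = ad + bc` and `B = ψ ∘ h`
  let hyp : A →+ A →+ ZMod 2 :=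
    ((AddMonoidHom.mul.comp (AddMonoidHom.fst (ZMod 2) (ZMod 2))).compl₂ (AddMonoidHom.snd (ZMod 2) (ZMod 2))) +
      ((AddMonoidHom.mul.comp (AddMonoidHom.snd (ZMod 2) (ZMod 2))).compl₂ (AddMonoidHom.fst (ZMod 2) (ZMod 2)))
  have hhyp : ∀ x y : A, hyp x y = x.1 * y.2 + x.2 * y.1 := fun _ _ ↦ rfl
  let B : A →+ A →+ AddCircle (1 : ℚ) := hyp.compr₂ ψ
  have hB : ∀ x y : A, B x y = ψ (x.1 * y.2 + x.2 * y.1) := fun _ _ ↦ rfl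
  have hnd : ∀ x : A, (∀ y, B x y = 0) → x = 0 := by
    intro x hx
    have e1 : ψ x.1 = 0 := by simpa [hB] using hx (0, 1)
    have e2 : ψ x.2 = 0 := by simpa [hB] using hx (1, 0)
    exact Prod.ext (hψinj _ e1) (hψinj _ e2)
  have halt : ∀ x : A, B x x = 0 := by
    intro x
    rw [hB, show x.1 * x.2 + x.2 * x.1 = 0 by
      have : ∀ a b : ZMod 2, a * b + b * a = 0 := by decide
      exact this _ _, map_zero]
  have hinv : ∀ x y : A, B (g x) (g y) = B x y := by
    intro x y
    rw [hB, hB, hg, hg, add_comm]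
  -- the grade-1 free multiplicity is `1`
  have key := h 1 le_rfl A g B hg2 hnd halt hinv 1 le_rfl
  -- `N = 1 + g`, `N(x) = (x.1 + x.2, x.1 + x.2)`
  set N : A →+ A := ∑ i ∈ Finset.range (2 ^ 1), (g ^ i : AddMonoid.End A) with hN
  have hNx : ∀ x : A, N x = (x.1 + x.2, x.1 + x.2) := by
    intro x
    have e : N x = ∑ i ∈ Finset.range (2 ^ 1), (g ^ i) x := normSum_apply g _ x
    rw [e, pow_one, sum_range_succ, sum_range_one, pow_zero, pow_one, AddMonoid.End.coe_one, id, hg,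
      Prod.ext_iff]
    exact ⟨rfl, add_comm _ _⟩
  -- `A[2] = ⊤`, `2^0 A = ⊤`, `2 A = 0`
  have h2x : ∀ x : A, (2 : ℕ) • x = 0 := by decide
  have hT : AddSubgroup.torsionBy A 2 = ⊤ := by
    rw [eq_top_iff]
    intro x _
    rw [show (2 : ℤ) = ((2 : ℕ) : ℤ) from rfl, AddSubgroup.torsionBy.nsmul_iff]
    exact h2x x
  have hU : ((2 ^ (1 - 1)) • AddMonoidHom.id A).range ⊓ AddSubgroup.torsionBy A 2 = ⊤ := by
    rw [hT, inf_top_eq, Nat.sub_self, pow_zero, one_nsmul, AddMonoidHom.range_eq_top]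
    exact fun x ↦ ⟨x, rfl⟩
  have hU' : ((2 ^ (1 + 1 - 1)) • AddMonoidHom.id A).range ⊓ AddSubgroup.torsionBy A 2 = ⊥ := by
    rw [eq_bot_iff]
    rintro x ⟨⟨a, rfl⟩, -⟩
    rw [AddSubgroup.mem_bot, AddMonoidHom.nsmul_apply, AddMonoidHom.id_apply, show 1 + 1 - 1 = 1 from rfl,
      pow_one]
    exact h2x a
  -- `#N(A) = 2`: `N(A) ≤ ker N`, both nontrivial, `#ker N · #N(A) = #A = 4`
  have hcardA : Nat.card A = 4 := by
    rw [Nat.card_prod, Nat.card_zmod]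
  have hprod : Nat.card N.ker * Nat.card N.range = 4 := by
    rw [← AddSubgroup.index_ker, AddSubgroup.card_mul_index, hcardA]
  have hker2 : 2 ≤ Nat.card N.ker := by
    have hmem : ((1, 1) : A) ∈ N.ker := by rw [AddMonoidHom.mem_ker, hNx]; decide
    have hne : (⟨(1, 1), hmem⟩ : N.ker) ≠ 0 := fun h0 ↦ by
      have h1 : ((1, 1) : A).1 = (0 : A).1 := congrArg (fun z : N.ker ↦ (z : A).1) h0
      exact absurd h1 (by decide)
    haveI : Nontrivial N.ker := ⟨⟨_, 0, hne⟩⟩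
    exact Finite.one_lt_card
  have hrange2 : 2 ≤ Nat.card N.range := by
    have hmem : ((1, 1) : A) ∈ N.range := ⟨(1, 0), by rw [hNx]; decide⟩
    have hne : (⟨(1, 1), hmem⟩ : N.range) ≠ 0 := fun h0 ↦ by
      have h1 : ((1, 1) : A).1 = (0 : A).1 := congrArg (fun z : N.range ↦ (z : A).1) h0
      exact absurd h1 (by decide)
    haveI : Nontrivial N.range := ⟨⟨_, 0, hne⟩⟩
    exact Finite.one_lt_card
  have hrange : Nat.card N.range = 2 := by
    have h1 : Nat.card N.ker * 2 ≤ 4 := (Nat.mul_le_mul_left _ hrange2).trans hprod.le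
    have hk : Nat.card N.ker = 2 := by omega
    rw [hk] at hprod
    omega
  rw [hU, hU', ← AddMonoidHom.range_eq_map, sup_bot_eq, hrange, AddSubgroup.card_bot, Nat.log_one_right,
    Nat.sub_zero, show Nat.log 2 2 = 1 by decide] at key
  exact Nat.not_even_one key

end Summit.BirchSwinnertonDyer.BirchSwinnertonDyer.Theorems.SignedMuAtTwo.EvenSymplecticFreeParity

end
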